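import Literature.NumberTheory.Sieve.FordMaynardSequence
import Literature.NumberTheory.Sieve.FordMaynardFragmentationSymm
import HarnessLib

/-!
# Ford–Maynard's Type-I sums: the error terms

Fifth file of the arithmetic half of Theorem 6.3 (a) / Theorem 9.1 of K. Ford, J. Maynard,
*On the theory of prime producing sieves* (arXiv:2407.14368). Everything here is PROVED. With
`Vsum = ∑_s (1/s!) injSum_s` (`FordMaynardSequence.lean`) and the vanishing of
`∑_s (1/s!) primeTupleIntegral_s` (`FordMaynardPrimeSumsSlices.lean`), the Type-I bound
`|∑_{r ≤ R, x/2 < mr} w_{mr}| ≪ x/(m (log x)^A)` ((construction-TypeI) of §6.2, with a log-power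
saving) reduces to two error estimates proved here:

* tuples with a repeated prime or a prime dividing `m` ("removing the condition `(r,m)=1`" in the
  proof of Lemma 5.11, and the squarefreeness of `r`): `|primeTupleSum_s − injSum_s| ≪ x^{c₁−η/2} + 1`
  (`abs_primeTupleSum_sub_injSum_le`), by symmetry, peeling the last prime, and counting prime
  tuples in a convex region with `exists_primeTupleSum_approx` applied to an indicator function;
* the comparison of `primeTupleSum_s` with `primeTupleIntegral_s` for the test functions `mainG`
  (`abs_primeTupleSum_mainG_sub_integral_le`): `mainG` is decomposed along the piecewise-Lipschitz
  structure of `h` (Definition 6.2 (b)) into functions Lipschitz on convex sets, to which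
  `exists_primeTupleSum_approx` applies.

## References

* K. Ford, J. Maynard, *On the theory of prime producing sieves*, arXiv:2407.14368v1 (2024), §5.5
  (proof of Lemma 5.11) and §6.2 (proof of Theorem 6.3 (a)). [FordMaynard2024PrimeSieves]
-/

noncomputable section

open MeasureTheory Finset Real

namespace Literature.NumberTheory.Sieve.FordMaynard

/-! ### Counting prime tuples in a simplex corner -/

/-- The region `{y : yᵢ ≥ η₁, |y| ≤ Y}`. [folklore] -/
def cornerSet (d : ℕ) (η₁ Y : ℝ) : Set (Fin d → ℝ) := {y | (∀ i, η₁ ≤ y i) ∧ ∑ i, y i ≤ Y}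

/-- `cornerSet` is convex. [folklore] -/
theorem convex_cornerSet (d : ℕ) (η₁ Y : ℝ) : Convex ℝ (cornerSet d η₁ Y) := by
  intro y hy z hz a b ha hb hab
  have hη : a * η₁ + b * η₁ = η₁ := by rw [← add_mul, hab, one_mul]
  have hY : a * Y + b * Y = Y := by rw [← add_mul, hab, one_mul]
  refine ⟨fun i => ?_, ?_⟩
  · simp only [Pi.add_apply, Pi.smul_apply, smul_eq_mul]
    linarith [mul_le_mul_of_nonneg_left (hy.1 i) ha, mul_le_mul_of_nonneg_left (hz.1 i) hb]
  · simp only [Pi.add_apply, Pi.smul_apply, smul_eq_mul, Finset.sum_add_distrib, ← Finset.mul_sum]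
    linarith [mul_le_mul_of_nonneg_left hy.2 ha, mul_le_mul_of_nonneg_left hz.2 hb]

/-- `cornerSet` is measurable. [folklore] -/
theorem measurableSet_cornerSet (d : ℕ) (η₁ Y : ℝ) : MeasurableSet (cornerSet d η₁ Y) := by
  have : cornerSet d η₁ Y = (⋂ i, {y : Fin d → ℝ | η₁ ≤ y i}) ∩ {y | ∑ i, y i ≤ Y} := by
    ext y; simp [cornerSet]
  rw [this]
  exact (MeasurableSet.iInter fun i => measurableSet_le measurable_const (measurable_pi_apply i)).inter
    (measurableSet_le (Finset.measurable_sum _ fun i _ => measurable_pi_apply i) measurable_const)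

/-- The indicator test function of `cornerSet`. [folklore] -/
def cornerInd (d : ℕ) (η₁ Y : ℝ) : (Fin d → ℝ) → ℝ := Set.indicator (cornerSet d η₁ Y) fun _ => 1

/-- Values of `cornerInd`. [folklore] -/
theorem cornerInd_of_mem {d : ℕ} {η₁ Y : ℝ} {y : Fin d → ℝ} (hy : y ∈ cornerSet d η₁ Y) :
    cornerInd d η₁ Y y = 1 := Set.indicator_of_mem hy _

/-- Values of `cornerInd`. [folklore] -/
theorem cornerInd_of_notMem {d : ℕ} {η₁ Y : ℝ} {y : Fin d → ℝ} (hy : y ∉ cornerSet d η₁ Y) :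
    cornerInd d η₁ Y y = 0 := Set.indicator_of_notMem hy _

/-- **Counting prime tuples in a corner**: for `0 < η₁ ≤ 1` and `d` there are `C, X` with
`#{q ∈ primes(≤x)^d : log qᵢ/log x ≥ η₁, ∑ log qᵢ/log x ≤ Y} ≤ C (x^Y + 1)` for all `x ≥ X`,
`Y ≤ 1` (the prime tuple sum of the indicator; from `exists_primeTupleSum_approx` with `A = 0` and
the bound `∫_{corner} ∏ x^{yᵢ}dyᵢ/yᵢ ≤ η₁^{-d} x^Y`). [cite: FordMaynard2024PrimeSieves, Lemma 5.11 (proof, (Qstar))] -/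
theorem exists_primeTupleSum_cornerInd_le (η₁ : ℝ) (hη₁ : 0 < η₁) (hη₁1 : η₁ ≤ 1) (d : ℕ) :
    ∃ C : ℝ, 0 ≤ C ∧ ∃ X : ℝ, 2 ≤ X ∧ ∀ x : ℝ, X ≤ x → ∀ Y : ℝ, Y ≤ 1 →
      primeTupleSum d x (cornerInd d η₁ Y) ≤ C * (x ^ Y + 1) := by
  obtain ⟨C, hC0, X, hX2, hF2⟩ := exists_primeTupleSum_approx η₁ hη₁ hη₁1 0 d
  refine ⟨C + (1 / η₁) ^ d + 1, by positivity, X, hX2, fun x hx Y hY => ?_⟩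
  have hx1 : 1 ≤ x := by linarith
  have hx0 : 0 < x := by linarith
  have hU := convex_cornerSet d η₁ Y
  have hUm := measurableSet_cornerSet d η₁ Y
  have hGm : Measurable (cornerInd d η₁ Y) := measurable_const.indicator hUm
  have key := hF2 x hx (cornerSet d η₁ Y) (cornerInd d η₁ Y) 0 1 Y hU hUm (fun y hy i => hy.1 i)
    (fun y hy => hy.2) hY le_rfl zero_le_one hGm
    (fun y hy y' hy' => by rw [cornerInd_of_mem hy, cornerInd_of_mem hy', sub_self, abs_zero, zero_mul])
    (fun y => by
      by_cases hy : y ∈ cornerSet d η₁ Y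
      · rw [cornerInd_of_mem hy, abs_one]
      · rw [cornerInd_of_notMem hy, abs_zero]; exact zero_le_one)
    (fun y hy => cornerInd_of_notMem hy)
  rw [zero_add, mul_one, pow_zero, div_one] at key
  -- the integral is at most `η₁^{-d} x^Y`
  have hint : primeTupleIntegral d x (cornerInd d η₁ Y) ≤ (1 / η₁) ^ d * x ^ Y := by
    unfold primeTupleIntegral
    have hbox : ∀ y ∈ cornerSet d η₁ Y, ∀ i, η₁ ≤ y i ∧ y i ≤ 1 := by
      intro y hy i
      refine ⟨hy.1 i, ?_⟩
      have : y i + ∑ j ∈ Finset.univ.erase i, y j = ∑ j, y j := Finset.add_sum_erase _ _ (Finset.mem_univ i)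
      have hrest : 0 ≤ ∑ j ∈ Finset.univ.erase i, y j := Finset.sum_nonneg fun j _ => hη₁.le.trans (hy.1 j)
      linarith [hy.2]
    have hptw : ∀ y, cornerInd d η₁ Y y * tupleWeight x y ≤
        Set.indicator (Set.Icc (fun _ : Fin d => η₁) (fun _ => 1)) (fun _ => (1 / η₁) ^ d * x ^ Y) y := by
      intro y
      by_cases hy : y ∈ cornerSet d η₁ Y
      · rw [cornerInd_of_mem hy, one_mul, Set.indicator_of_mem (show y ∈ Set.Icc (fun _ : Fin d => η₁) (fun _ => 1) from
          ⟨fun i => (hbox y hy i).1, fun i => (hbox y hy i).2⟩)]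
        unfold tupleWeight
        calc ∏ i, x ^ (y i) / y i ≤ ∏ i, x ^ (y i) * (1 / η₁) := by
              refine Finset.prod_le_prod (fun i _ => div_nonneg (Real.rpow_nonneg hx0.le _)
                (hη₁.le.trans (hbox y hy i).1)) fun i _ => ?_
              rw [div_eq_mul_one_div]
              exact mul_le_mul_of_nonneg_left (one_div_le_one_div_of_le hη₁ (hbox y hy i).1)
                (Real.rpow_nonneg hx0.le _)
          _ = (1 / η₁) ^ d * x ^ (∑ i, y i) := by
              rw [Finset.prod_mul_distrib, Real.rpow_sum_of_pos hx0, Finset.prod_const, Finset.card_univ,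
                Fintype.card_fin, mul_comm]
          _ ≤ (1 / η₁) ^ d * x ^ Y :=
              mul_le_mul_of_nonneg_left (Real.rpow_le_rpow_of_exponent_le hx1 hy.2) (by positivity)
      · rw [cornerInd_of_notMem hy, zero_mul]
        exact Set.indicator_nonneg (fun _ _ => by positivity) y
    have hconst_int : Integrable (Set.indicator (Set.Icc (fun _ : Fin d => η₁) (fun _ => 1))
        (fun _ : Fin d → ℝ => (1 / η₁) ^ d * x ^ Y)) := by
      rw [integrable_indicator_iff measurableSet_Icc]
      exact integrableOn_const (isCompact_Icc.measure_lt_top.ne)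
    have hGint : Integrable (fun y => cornerInd d η₁ Y y * tupleWeight x y) := by
      refine integrable_of_bdd_of_support_box (hGm.mul (measurable_tupleWeight hx0))
        (B := (1 / η₁) ^ d * x ^ Y) (a := η₁) (b := 1) (fun y => ?_) (fun y hy => ?_)
      · rw [abs_of_nonneg]
        · refine (hptw y).trans (Set.indicator_le_self' (fun _ _ => by positivity) y)
        · by_cases hy : y ∈ cornerSet d η₁ Y
          · rw [cornerInd_of_mem hy, one_mul]; exact (tupleWeight_bounds hx1 hη₁ (hbox y hy)).1
          · rw [cornerInd_of_notMem hy, zero_mul]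
      · have hy' : y ∈ cornerSet d η₁ Y := by
          by_contra hc; rw [cornerInd_of_notMem hc, zero_mul] at hy; exact hy rfl
        exact ⟨fun i => (hbox y hy' i).1, fun i => (hbox y hy' i).2⟩
    calc ∫ y, cornerInd d η₁ Y y * tupleWeight x y
        ≤ ∫ y, Set.indicator (Set.Icc (fun _ : Fin d => η₁) (fun _ => 1)) (fun _ => (1 / η₁) ^ d * x ^ Y) y :=
          integral_mono hGint hconst_int hptw
      _ = (1 / η₁) ^ d * x ^ Y * (volume (Set.Icc (fun _ : Fin d => η₁) (fun _ => 1))).toReal := by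
          rw [integral_indicator measurableSet_Icc, setIntegral_const, smul_eq_mul, mul_comm]; rfl
      _ ≤ (1 / η₁) ^ d * x ^ Y * 1 := by
          refine mul_le_mul_of_nonneg_left ?_ (by positivity)
          rw [Real.volume_Icc_pi_toReal (fun _ => hη₁1)]
          simp only [Finset.prod_const, Finset.card_univ, Fintype.card_fin]
          exact pow_le_one₀ (by linarith) (by linarith)
      _ = (1 / η₁) ^ d * x ^ Y := mul_one _
  have hxY : 0 < x ^ Y := Real.rpow_pos_of_pos hx0 Y
  rw [abs_le] at key
  have hηd : 0 ≤ (1 / η₁) ^ d := by positivity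
  have hexp : (C + (1 / η₁) ^ d + 1) * (x ^ Y + 1) =
      (C + (1 / η₁) ^ d) * x ^ Y + ((C + (1 / η₁) ^ d) + x ^ Y + 1) := by ring
  have hmul : 0 ≤ (C + (1 / η₁) ^ d) * x ^ Y := by positivity
  rw [hexp]
  nlinarith [key.2, hint, hxY, hC0]

/-! ### Symmetry of the test functions and re-indexing of tuple sums -/

/-- The permutation of `Fin (t + s)` acting as `σ` on the last `s` coordinates. [folklore] -/
def liftPerm (t : ℕ) {s : ℕ} (σ : Equiv.Perm (Fin s)) : Equiv.Perm (Fin (t + s)) :=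
  (finSumFinEquiv (m := t) (n := s)).permCongr (Equiv.sumCongr (Equiv.refl (Fin t)) σ)

/-- `liftPerm σ` fixes the first `t` coordinates. [folklore] -/
theorem liftPerm_castAdd (t : ℕ) {s : ℕ} (σ : Equiv.Perm (Fin s)) (i : Fin t) :
    liftPerm t σ (Fin.castAdd s i) = Fin.castAdd s i := by
  simp [liftPerm, Equiv.permCongr_apply]

/-- `liftPerm σ` acts as `σ` on the last `s` coordinates. [folklore] -/
theorem liftPerm_natAdd (t : ℕ) {s : ℕ} (σ : Equiv.Perm (Fin s)) (j : Fin s) :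
    liftPerm t σ (Fin.natAdd t j) = Fin.natAdd t (σ j) := by
  simp [liftPerm, Equiv.permCongr_apply]

/-- `append u (y ∘ σ) = append u y ∘ liftPerm σ`. [folklore] -/
theorem append_comp_perm {t s : ℕ} (u : Fin t → ℝ) (y : Fin s → ℝ) (σ : Equiv.Perm (Fin s)) :
    Fin.append u (y ∘ σ) = Fin.append u y ∘ liftPerm t σ := by
  funext i
  refine Fin.addCases (fun j => ?_) (fun j => ?_) i
  · simp only [Fin.append_left, Function.comp_apply, liftPerm_castAdd]
  · simp only [Fin.append_right, Function.comp_apply, liftPerm_natAdd]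

/-- **Symmetry of `mainG`** in its `s` variables (for `h ∈ 𝒮`). [cite: FordMaynard2024PrimeSieves, Definition 6.1] -/
theorem mainG_comp_perm {h : VecFn} (hsym : h.IsSymmetric) (t s : ℕ) (u : Fin t → ℝ) (c₀ c₁ : ℝ)
    (y : Fin s → ℝ) (σ : Equiv.Perm (Fin s)) :
    mainG h t s u c₀ c₁ (y ∘ σ) = mainG h t s u c₀ c₁ y := by
  unfold mainG
  have hsum : ∑ j, (y ∘ σ) j = ∑ j, y j := Equiv.sum_comp σ y
  rw [hsum]
  split_ifs
  · have hn : normVec u (y ∘ σ) = normVec u y ∘ liftPerm t σ := by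
      unfold normVec
      rw [hsum, append_comp_perm]
      rfl
    rw [hn, hsym _ (liftPerm t σ)]
  · rfl

/-- Re-indexing a tuple sum by a permutation of the coordinates. [folklore] -/
theorem sum_piFinset_comp_perm {s : ℕ} (P : Finset ℕ) (σ : Equiv.Perm (Fin s)) (F : (Fin s → ℕ) → ℝ) :
    ∑ q ∈ Fintype.piFinset (fun _ : Fin s => P), F (q ∘ σ) =
      ∑ q ∈ Fintype.piFinset (fun _ : Fin s => P), F q := by
  refine Finset.sum_nbij' (fun q => q ∘ σ) (fun q => q ∘ σ.symm) ?_ ?_ ?_ ?_ ?_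
  · intro q hq; rw [Fintype.mem_piFinset] at hq ⊢; exact fun i => hq _
  · intro q hq; rw [Fintype.mem_piFinset] at hq ⊢; exact fun i => hq _
  · intro q _; funext i; simp
  · intro q _; funext i; simp
  · intro q _; rfl

/-- `logVec` commutes with permutations. [folklore] -/
theorem logVec_comp_perm {s : ℕ} (x : ℝ) (q : Fin s → ℕ) (σ : Equiv.Perm (Fin s)) :
    logVec x (q ∘ σ) = logVec x q ∘ σ := rfl

/-! ### Support of the test functions -/

/-- If `mainG(y) ≠ 0` then `y` is in range and all `yᵢ ≥ η(λ + |y|)`. [cite: FordMaynard2024PrimeSieves, §6.2] -/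
theorem mainG_ne_zero_imp {h : VecFn} {η : ℝ} (hsupp : ∀ (k : ℕ) (v : Fin k → ℝ), h k v ≠ 0 → ∀ i, η ≤ v i)
    {t s : ℕ} {u : Fin t → ℝ} {c₀ c₁ : ℝ} (hρ : 0 < (∑ i, u i) + c₀) {y : Fin s → ℝ}
    (hy : mainG h t s u c₀ c₁ y ≠ 0) :
    (c₀ < ∑ i, y i ∧ ∑ i, y i ≤ c₁) ∧ ∀ i, η * ((∑ i, u i) + ∑ i, y i) ≤ y i := by
  unfold mainG at hy
  split_ifs at hy with hc
  · refine ⟨hc, fun i => ?_⟩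
    have hρ' : 0 < (∑ i, u i) + ∑ i, y i := by linarith [hc.1]
    have := hsupp _ _ hy (Fin.natAdd t i)
    simp only [normVec, Fin.append_right] at this
    rwa [le_div_iff₀ hρ'] at this
  · exact absurd rfl hy

/-- The corner bound for a test function value at an extended vector: if
`mainG(snoc y' p) ≠ 0` with `yₚ`-coordinate `p ≥ ... `, then `y'` lies in the corner
`{y'ᵢ ≥ η/2, |y'| ≤ c₁ − η/2}` (when `λ + c₀ ≥ 1/2`). [folklore] -/
theorem abs_mainG_snoc_le_cornerInd {h : VecFn} {η Hb : ℝ} (hη : 0 < η)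
    (hsupp : ∀ (k : ℕ) (v : Fin k → ℝ), h k v ≠ 0 → ∀ i, η ≤ v i)
    (hbdd : ∀ (k : ℕ) (v : Fin k → ℝ), |h k v| ≤ Hb) {t d : ℕ} {u : Fin t → ℝ} {c₀ c₁ : ℝ}
    (hρ : 1 / 2 ≤ (∑ i, u i) + c₀) (y' : Fin d → ℝ) (p : ℝ) :
    |mainG h t (d + 1) u c₀ c₁ (Fin.snoc y' p)| ≤ Hb * cornerInd d (η / 2) (c₁ - η / 2) y' := by
  have hHb : 0 ≤ Hb := (abs_nonneg _).trans (hbdd 0 fun i => i.elim0)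
  by_cases hz : mainG h t (d + 1) u c₀ c₁ (Fin.snoc y' p) = 0
  · rw [hz, abs_zero]
    unfold cornerInd
    exact mul_nonneg hHb (Set.indicator_nonneg (fun _ _ => zero_le_one) _)
  · obtain ⟨hc, hcoord⟩ := mainG_ne_zero_imp hsupp (by linarith) hz
    rw [sum_snoc] at hc hcoord
    have hρ1 : 1 / 2 ≤ (∑ i, u i) + ((∑ i, y' i) + p) := by linarith [hc.1]
    have hlow : ∀ i, η / 2 ≤ (Fin.snoc y' p : Fin (d + 1) → ℝ) i := by
      intro i
      have := hcoord i
      nlinarith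
    have hmem : y' ∈ cornerSet d (η / 2) (c₁ - η / 2) := by
      refine ⟨fun i => ?_, ?_⟩
      · have := hlow (Fin.castSucc i); simpa only [Fin.snoc_castSucc] using this
      · have := hlow (Fin.last d); simp only [Fin.snoc_last] at this; linarith [hc.2]
    rw [cornerInd_of_mem hmem, mul_one]
    unfold mainG; split_ifs
    · exact hbdd _ _
    · rw [abs_zero]; exact hHb

/-! ### Tuples with a repeated prime -/

/-- A permutation of `Fin (d+2)` taking the last two positions to a given pair `i ≠ j`. [folklore] -/
theorem exists_perm_lastTwo {d : ℕ} {i j : Fin (d + 2)} (hij : i ≠ j) :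
    ∃ σ : Equiv.Perm (Fin (d + 2)), σ (Fin.castSucc (Fin.last d)) = i ∧ σ (Fin.last (d + 1)) = j := by
  classical
  set a : Fin (d + 2) := Fin.castSucc (Fin.last d) with ha
  set b : Fin (d + 2) := Fin.last (d + 1) with hb
  have hab : a ≠ b := by
    rw [ha, hb]; exact (Fin.castSucc_lt_last (Fin.last d)).ne
  set σ₁ : Equiv.Perm (Fin (d + 2)) := Equiv.swap a i with hσ₁
  have h1 : σ₁ a = i := by rw [hσ₁, Equiv.swap_apply_left]
  set b' := σ₁ b with hb'
  have hb'i : b' ≠ i := by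
    intro h
    have : σ₁ b = σ₁ a := by rw [← hb', h, h1]
    exact hab (σ₁.injective this).symm
  refine ⟨σ₁.trans (Equiv.swap b' j), ?_, ?_⟩
  · rw [Equiv.trans_apply, h1, Equiv.swap_apply_of_ne_of_ne hb'i.symm hij]
  · rw [Equiv.trans_apply, ← hb', Equiv.swap_apply_left]

/-- **Repeated prime at the last two positions**:
`∑_{q ∈ P^{d+2}, q_{d} = q_{d+1}} |G(q)| ≤ H_b · primeTupleSum (d+1) (corner indicator)`.
[cite: FordMaynard2024PrimeSieves, Lemma 5.11 (proof)] -/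
theorem sum_lastTwo_eq_le {h : VecFn} {η Hb : ℝ} (hη : 0 < η)
    (hsupp : ∀ (k : ℕ) (v : Fin k → ℝ), h k v ≠ 0 → ∀ i, η ≤ v i)
    (hbdd : ∀ (k : ℕ) (v : Fin k → ℝ), |h k v| ≤ Hb) {t d : ℕ} {u : Fin t → ℝ} {c₀ c₁ : ℝ}
    (hρ : 1 / 2 ≤ (∑ i, u i) + c₀) (x : ℝ) :
    ∑ q ∈ (Fintype.piFinset fun _ : Fin (d + 2) => Nat.primesLE ⌊x⌋₊).filter
        (fun q => q (Fin.castSucc (Fin.last d)) = q (Fin.last (d + 1))),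
        |mainG h t (d + 2) u c₀ c₁ (logVec x q)| ≤
      Hb * primeTupleSum (d + 1) x (cornerInd (d + 1) (η / 2) (c₁ - η / 2)) := by
  classical
  set P := Nat.primesLE ⌊x⌋₊ with hP
  rw [Finset.sum_filter, sum_piFinset_succ]
  unfold primeTupleSum
  rw [Finset.mul_sum]
  refine Finset.sum_le_sum fun q' hq' => ?_
  rw [Fintype.mem_piFinset] at hq'
  have hinner : ∑ p ∈ P, (if (Fin.snoc q' p : Fin (d + 2) → ℕ) (Fin.castSucc (Fin.last d)) =
      (Fin.snoc q' p : Fin (d + 2) → ℕ) (Fin.last (d + 1))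
      then |mainG h t (d + 2) u c₀ c₁ (logVec x (Fin.snoc q' p))| else 0) =
      |mainG h t (d + 2) u c₀ c₁ (logVec x (Fin.snoc q' (q' (Fin.last d))))| := by
    simp only [Fin.snoc_castSucc, Fin.snoc_last]
    rw [Finset.sum_ite_eq P (q' (Fin.last d)) (fun p => |mainG h t (d + 2) u c₀ c₁ (logVec x (Fin.snoc q' p))|),
      if_pos (hq' _)]
  rw [hinner, logVec_snoc]
  exact abs_mainG_snoc_le_cornerInd hη hsupp hbdd hρ _ _

/-- **Tuples with a repeated prime at positions `i ≠ j`.** [cite: FordMaynard2024PrimeSieves, Lemma 5.11 (proof)] -/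
theorem sum_pair_eq_le {h : VecFn} (hsym : h.IsSymmetric) {η Hb : ℝ} (hη : 0 < η)
    (hsupp : ∀ (k : ℕ) (v : Fin k → ℝ), h k v ≠ 0 → ∀ i, η ≤ v i)
    (hbdd : ∀ (k : ℕ) (v : Fin k → ℝ), |h k v| ≤ Hb) {t d : ℕ} {u : Fin t → ℝ} {c₀ c₁ : ℝ}
    (hρ : 1 / 2 ≤ (∑ i, u i) + c₀) (x : ℝ) {i j : Fin (d + 2)} (hij : i ≠ j) :
    ∑ q ∈ (Fintype.piFinset fun _ : Fin (d + 2) => Nat.primesLE ⌊x⌋₊).filter (fun q => q i = q j),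
        |mainG h t (d + 2) u c₀ c₁ (logVec x q)| ≤
      Hb * primeTupleSum (d + 1) x (cornerInd (d + 1) (η / 2) (c₁ - η / 2)) := by
  classical
  obtain ⟨σ, hσa, hσb⟩ := exists_perm_lastTwo hij
  set P := Nat.primesLE ⌊x⌋₊ with hP
  set F : (Fin (d + 2) → ℕ) → ℝ := fun q =>
    if q (Fin.castSucc (Fin.last d)) = q (Fin.last (d + 1)) then |mainG h t (d + 2) u c₀ c₁ (logVec x q)| else 0
    with hF
  have hre := sum_piFinset_comp_perm P σ F
  have hF' : ∀ q : Fin (d + 2) → ℕ, F (q ∘ σ) =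
      if q i = q j then |mainG h t (d + 2) u c₀ c₁ (logVec x q)| else 0 := by
    intro q
    simp only [hF, Function.comp_apply, hσa, hσb, logVec_comp_perm, mainG_comp_perm hsym]
  rw [Finset.sum_filter, ← Finset.sum_congr rfl (fun q _ => hF' q), hre, hF, ← Finset.sum_filter]
  exact sum_lastTwo_eq_le hη hsupp hbdd hρ x

/-! ### Tuples containing a prime factor of `m` -/

/-- **A prime of `T` at the last position.** [cite: FordMaynard2024PrimeSieves, Lemma 5.11 (proof)] -/
theorem sum_last_mem_le {h : VecFn} {η Hb : ℝ} (hη : 0 < η)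
    (hsupp : ∀ (k : ℕ) (v : Fin k → ℝ), h k v ≠ 0 → ∀ i, η ≤ v i)
    (hbdd : ∀ (k : ℕ) (v : Fin k → ℝ), |h k v| ≤ Hb) {t d : ℕ} {u : Fin t → ℝ} {c₀ c₁ : ℝ}
    (hρ : 1 / 2 ≤ (∑ i, u i) + c₀) (x : ℝ) (T : Finset ℕ) :
    ∑ q ∈ (Fintype.piFinset fun _ : Fin (d + 1) => Nat.primesLE ⌊x⌋₊).filter
        (fun q => q (Fin.last d) ∈ T), |mainG h t (d + 1) u c₀ c₁ (logVec x q)| ≤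
      Hb * T.card * primeTupleSum d x (cornerInd d (η / 2) (c₁ - η / 2)) := by
  classical
  have hHb : 0 ≤ Hb := (abs_nonneg _).trans (hbdd 0 fun i => i.elim0)
  set P := Nat.primesLE ⌊x⌋₊ with hP
  rw [Finset.sum_filter, sum_piFinset_succ]
  unfold primeTupleSum
  rw [Finset.mul_sum]
  refine Finset.sum_le_sum fun q' _ => ?_
  simp only [Fin.snoc_last]
  rw [← Finset.sum_filter]
  calc ∑ p ∈ P.filter (fun p => p ∈ T), |mainG h t (d + 1) u c₀ c₁ (logVec x (Fin.snoc q' p))|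
      ≤ ∑ p ∈ P.filter (fun p => p ∈ T), Hb * cornerInd d (η / 2) (c₁ - η / 2) (logVec x q') := by
        refine Finset.sum_le_sum fun p _ => ?_
        rw [logVec_snoc]
        exact abs_mainG_snoc_le_cornerInd hη hsupp hbdd hρ _ _
    _ = (P.filter (fun p => p ∈ T)).card * (Hb * cornerInd d (η / 2) (c₁ - η / 2) (logVec x q')) := by
        rw [Finset.sum_const, nsmul_eq_mul]
    _ ≤ T.card * (Hb * cornerInd d (η / 2) (c₁ - η / 2) (logVec x q')) := by
        refine mul_le_mul_of_nonneg_right ?_ (mul_nonneg hHb ?_)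
        · exact_mod_cast Finset.card_le_card (fun p hp => (Finset.mem_filter.1 hp).2)
        · unfold cornerInd; exact Set.indicator_nonneg (fun _ _ => zero_le_one) _
    _ = Hb * T.card * cornerInd d (η / 2) (c₁ - η / 2) (logVec x q') := by ring

/-- **A prime of `T` at position `i`.** [cite: FordMaynard2024PrimeSieves, Lemma 5.11 (proof)] -/
theorem sum_mem_le {h : VecFn} (hsym : h.IsSymmetric) {η Hb : ℝ} (hη : 0 < η)
    (hsupp : ∀ (k : ℕ) (v : Fin k → ℝ), h k v ≠ 0 → ∀ i, η ≤ v i)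
    (hbdd : ∀ (k : ℕ) (v : Fin k → ℝ), |h k v| ≤ Hb) {t d : ℕ} {u : Fin t → ℝ} {c₀ c₁ : ℝ}
    (hρ : 1 / 2 ≤ (∑ i, u i) + c₀) (x : ℝ) (T : Finset ℕ) (i : Fin (d + 1)) :
    ∑ q ∈ (Fintype.piFinset fun _ : Fin (d + 1) => Nat.primesLE ⌊x⌋₊).filter (fun q => q i ∈ T),
        |mainG h t (d + 1) u c₀ c₁ (logVec x q)| ≤
      Hb * T.card * primeTupleSum d x (cornerInd d (η / 2) (c₁ - η / 2)) := by
  classical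
  set σ : Equiv.Perm (Fin (d + 1)) := Equiv.swap (Fin.last d) i with hσ
  have hσl : σ (Fin.last d) = i := by rw [hσ, Equiv.swap_apply_left]
  set P := Nat.primesLE ⌊x⌋₊ with hP
  set F : (Fin (d + 1) → ℕ) → ℝ := fun q =>
    if q (Fin.last d) ∈ T then |mainG h t (d + 1) u c₀ c₁ (logVec x q)| else 0 with hF
  have hre := sum_piFinset_comp_perm P σ F
  have hF' : ∀ q : Fin (d + 1) → ℕ, F (q ∘ σ) =
      if q i ∈ T then |mainG h t (d + 1) u c₀ c₁ (logVec x q)| else 0 := by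
    intro q
    simp only [hF, Function.comp_apply, hσl, logVec_comp_perm, mainG_comp_perm hsym]
  rw [Finset.sum_filter, ← Finset.sum_congr rfl (fun q _ => hF' q), hre, hF, ← Finset.sum_filter]
  exact sum_last_mem_le hη hsupp hbdd hρ x T

/-! ### The bad tuples altogether -/

/-- **Removing repeated primes and primes dividing `m`**: for `s = d + 1 ≥ 1`,
`|primeTupleSum_s(mainG) − injSum_s| ≤ H_b s (s + ω(m)) · primeTupleSum_d(corner indicator)`.
[cite: FordMaynard2024PrimeSieves, Lemma 5.11 (proof: "we may remove the condition (r,m)=1")] -/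
theorem abs_primeTupleSum_sub_injSum_le {h : VecFn} (hsym : h.IsSymmetric) {η Hb : ℝ} (hη : 0 < η)
    (hsupp : ∀ (k : ℕ) (v : Fin k → ℝ), h k v ≠ 0 → ∀ i, η ≤ v i)
    (hbdd : ∀ (k : ℕ) (v : Fin k → ℝ), |h k v| ≤ Hb) {x : ℝ} {m : ℕ} {c₁ : ℝ} (R : ℕ)
    (hρ : 1 / 2 ≤ (∑ i, uvec x m i) + Real.log (x / (2 * m)) / Real.log x)
    (hc₁ : c₁ = Real.log R / Real.log x) (d : ℕ) :
    |primeTupleSum (d + 1) x (mainG h m.primeFactors.card (d + 1) (uvec x m)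
        (Real.log (x / (2 * m)) / Real.log x) c₁) - injSum h x m R (d + 1)| ≤
      Hb * (d + 1) * (d + 1 + m.primeFactors.card) *
        primeTupleSum d x (cornerInd d (η / 2) (c₁ - η / 2)) := by
  classical
  subst hc₁
  have hHb : 0 ≤ Hb := (abs_nonneg _).trans (hbdd 0 fun i => i.elim0)
  set P := Nat.primesLE ⌊x⌋₊ with hP
  set T := m.primeFactors with hT
  set t := T.card with ht
  set c₀ := Real.log (x / (2 * m)) / Real.log x with hc₀
  set c₁ := Real.log R / Real.log x with hc₁
  set G : (Fin (d + 1) → ℕ) → ℝ := fun q => mainG h t (d + 1) (uvec x m) c₀ c₁ (logVec x q) with hG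
  set PS := primeTupleSum d x (cornerInd d (η / 2) (c₁ - η / 2)) with hPS
  have hPS0 : 0 ≤ PS := by
    rw [hPS]; unfold primeTupleSum
    exact Finset.sum_nonneg fun q _ => by unfold cornerInd; exact Set.indicator_nonneg (fun _ _ => zero_le_one) _
  set good : (Fin (d + 1) → ℕ) → Prop := fun q => Function.Injective q ∧ ∀ i, q i ∉ T with hgood
  -- the difference is the sum over the bad tuples
  have hdiff : primeTupleSum (d + 1) x (mainG h t (d + 1) (uvec x m) c₀ c₁) - injSum h x m R (d + 1) =
      ∑ q ∈ (Fintype.piFinset fun _ : Fin (d + 1) => P).filter (fun q => ¬ good q), G q := by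
    unfold primeTupleSum injSum
    rw [← Finset.sum_filter_add_sum_filter_not (Fintype.piFinset fun _ : Fin (d + 1) => P) good]
    ring
  rw [hdiff]
  -- union bound: bad ⇒ (some pair coincides) or (some entry lies in `T`)
  set pairs := (Finset.univ ×ˢ Finset.univ : Finset (Fin (d + 1) × Fin (d + 1))).filter (fun p => p.1 ≠ p.2)
    with hpairs
  have hptw : ∀ q ∈ (Fintype.piFinset fun _ : Fin (d + 1) => P),
      (if ¬ good q then |G q| else 0) ≤
        (∑ p ∈ pairs, if q p.1 = q p.2 then |G q| else 0) +
          ∑ i : Fin (d + 1), if q i ∈ T then |G q| else 0 := by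
    intro q _
    have h1 : 0 ≤ ∑ p ∈ pairs, (if q p.1 = q p.2 then |G q| else 0) :=
      Finset.sum_nonneg fun p _ => by split_ifs <;> simp
    have h2 : 0 ≤ ∑ i : Fin (d + 1), (if q i ∈ T then |G q| else 0) :=
      Finset.sum_nonneg fun i _ => by split_ifs <;> simp
    by_cases hbad : good q
    · rw [if_neg (fun h => h hbad)]; linarith
    · rw [if_pos hbad]
      have hbad' : ¬ Function.Injective q ∨ ∃ i, q i ∈ T := by
        by_contra hcon
        simp only [not_or, not_not, not_exists] at hcon
        exact hbad ⟨hcon.1, hcon.2⟩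
      rcases hbad' with hni | ⟨i, hi⟩
      · obtain ⟨a, b, hab, hne⟩ := Function.not_injective_iff.1 hni
        have hmem : (a, b) ∈ pairs := by
          rw [hpairs, Finset.mem_filter]; exact ⟨Finset.mem_product.2 ⟨Finset.mem_univ _, Finset.mem_univ _⟩, hne⟩
        have : |G q| ≤ ∑ p ∈ pairs, (if q p.1 = q p.2 then |G q| else 0) := by
          refine le_trans ?_ (Finset.single_le_sum (fun p _ => by split_ifs <;> simp) hmem)
          rw [if_pos hab]
        linarith
      · have : |G q| ≤ ∑ i : Fin (d + 1), (if q i ∈ T then |G q| else 0) := by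
          refine le_trans ?_ (Finset.single_le_sum (fun i _ => by split_ifs <;> simp) (Finset.mem_univ i))
          rw [if_pos hi]
        linarith
  calc |∑ q ∈ (Fintype.piFinset fun _ : Fin (d + 1) => P).filter (fun q => ¬ good q), G q|
      ≤ ∑ q ∈ (Fintype.piFinset fun _ : Fin (d + 1) => P).filter (fun q => ¬ good q), |G q| :=
        Finset.abs_sum_le_sum_abs _ _
    _ = ∑ q ∈ (Fintype.piFinset fun _ : Fin (d + 1) => P), (if ¬ good q then |G q| else 0) :=
        Finset.sum_filter _ _
    _ ≤ ∑ q ∈ (Fintype.piFinset fun _ : Fin (d + 1) => P),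
          ((∑ p ∈ pairs, if q p.1 = q p.2 then |G q| else 0) +
            ∑ i : Fin (d + 1), if q i ∈ T then |G q| else 0) := Finset.sum_le_sum hptw
    _ = (∑ p ∈ pairs, ∑ q ∈ (Fintype.piFinset fun _ : Fin (d + 1) => P).filter (fun q => q p.1 = q p.2), |G q|) +
          ∑ i : Fin (d + 1), ∑ q ∈ (Fintype.piFinset fun _ : Fin (d + 1) => P).filter (fun q => q i ∈ T), |G q| := by
        rw [Finset.sum_add_distrib, Finset.sum_comm, Finset.sum_comm (s := Fintype.piFinset _)]
        simp only [Finset.sum_filter]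
    _ ≤ (∑ _p ∈ pairs, Hb * PS) + ∑ _i : Fin (d + 1), Hb * t * PS := by
        refine add_le_add (Finset.sum_le_sum fun p hp => ?_) (Finset.sum_le_sum fun i _ => ?_)
        · rw [hpairs, Finset.mem_filter] at hp
          cases d with
          | zero => exact absurd (Fin.ext (by have := p.1.isLt; have := p.2.isLt; omega)) hp.2
          | succ d => exact sum_pair_eq_le hsym hη hsupp hbdd hρ x hp.2
        · exact sum_mem_le hsym hη hsupp hbdd hρ x T i
    _ ≤ Hb * (d + 1) * (d + 1 + t) * PS := by
        rw [Finset.sum_const, Finset.sum_const, Finset.card_univ, Fintype.card_fin, nsmul_eq_mul,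
          nsmul_eq_mul]
        have hcard : (pairs.card : ℝ) ≤ (d + 1) * (d + 1) := by
          have : pairs.card ≤ (Finset.univ ×ˢ Finset.univ : Finset (Fin (d + 1) × Fin (d + 1))).card :=
            Finset.card_filter_le _ _
          rw [Finset.card_product, Finset.card_univ, Fintype.card_fin] at this
          exact_mod_cast this
        push_cast
        nlinarith [mul_nonneg hHb hPS0, mul_nonneg (mul_nonneg hHb hPS0) (Nat.cast_nonneg t)]

/-! ### The normalisation map `y ↦ (u, y)/(λ + |y|)`: measurability, convexity, Lipschitz bound -/

/-- `normVec u` is measurable in `y`. [folklore] -/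
theorem measurable_normVec {t s : ℕ} (u : Fin t → ℝ) :
    Measurable (fun y : Fin s → ℝ => normVec u y) := by
  unfold normVec
  refine measurable_pi_lambda _ fun i => ?_
  refine Measurable.div ?_ (measurable_const.add (Finset.measurable_sum _ fun i _ => measurable_pi_apply i))
  refine Fin.addCases (fun j => ?_) (fun j => ?_) i
  · simp only [Fin.append_left]; exact measurable_const
  · simp only [Fin.append_right]; exact measurable_pi_apply j

/-- **`normVec` maps segments to segments**: for `y, y'` with positive denominators and
`a, b ≥ 0`, `a + b = 1`, `normVec u (a y + b y')` is a convex combination of `normVec u y` and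
`normVec u y'`. [folklore] -/
theorem normVec_convex_comb {t s : ℕ} (u : Fin t → ℝ) {y y' : Fin s → ℝ} {a b : ℝ}
    (ha : 0 ≤ a) (hb : 0 ≤ b) (hab : a + b = 1) (hρ : 0 < (∑ i, u i) + ∑ i, y i)
    (hρ' : 0 < (∑ i, u i) + ∑ i, y' i) :
    ∃ a' b' : ℝ, 0 ≤ a' ∧ 0 ≤ b' ∧ a' + b' = 1 ∧
      normVec u (a • y + b • y') = a' • normVec u y + b' • normVec u y' := by
  set ρ := (∑ i, u i) + ∑ i, y i with hρdef
  set ρ' := (∑ i, u i) + ∑ i, y' i with hρ'def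
  have hsumz : ∑ i, (a • y + b • y') i = a * ∑ i, y i + b * ∑ i, y' i := by
    simp only [Pi.add_apply, Pi.smul_apply, smul_eq_mul, Finset.sum_add_distrib, ← Finset.mul_sum]
  set ρz := (∑ i, u i) + ∑ i, (a • y + b • y') i with hρzdef
  have hρz : ρz = a * ρ + b * ρ' := by
    rw [hρzdef, hsumz, hρdef, hρ'def]
    have : (∑ i, u i) = (a + b) * ∑ i, u i := by rw [hab, one_mul]
    linear_combination this
  have hρz0 : 0 < ρz := by
    rw [hρz]
    rcases ha.eq_or_lt with h0 | h0
    · rw [← h0, zero_mul, zero_add]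
      have : b = 1 := by linarith
      rw [this, one_mul]; exact hρ'
    · nlinarith [mul_pos h0 hρ, mul_nonneg hb hρ'.le]
  refine ⟨a * ρ / ρz, b * ρ' / ρz, by positivity, by positivity, ?_, ?_⟩
  · rw [← add_div, ← hρz, div_self hρz0.ne']
  · funext i
    have hρ0 : ρ ≠ 0 := hρ.ne'
    have hρ'0 : ρ' ≠ 0 := hρ'.ne'
    have hρz0' : ρz ≠ 0 := hρz0.ne'
    show Fin.append u (a • y + b • y') i / ρz =
      a * ρ / ρz * (Fin.append u y i / ρ) + b * ρ' / ρz * (Fin.append u y' i / ρ')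
    refine Fin.addCases (fun j => ?_) (fun j => ?_) i
    · rw [Fin.append_left, Fin.append_left, Fin.append_left]
      have : a * ρ / ρz * (u j / ρ) + b * ρ' / ρz * (u j / ρ') = (a + b) * u j / ρz := by
        field_simp
      rw [this, hab, one_mul]
    · rw [Fin.append_right, Fin.append_right, Fin.append_right]
      simp only [Pi.add_apply, Pi.smul_apply, smul_eq_mul]
      field_simp

/-- **Lipschitz bound for `normVec`** (sup norms): if `|uᵢ| ≤ 1`, `|yᵢ|, |y'ᵢ| ≤ 1` and the
denominators are `≥ ρ₀ > 0`, then `‖normVec u y − normVec u y'‖ ≤ (2s/ρ₀² + 1/ρ₀) ‖y − y'‖`.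
[folklore] -/
theorem norm_normVec_sub_le {t s : ℕ} {u : Fin t → ℝ} (hu : ∀ i, |u i| ≤ 1) {ρ₀ : ℝ} (hρ₀ : 0 < ρ₀)
    {y y' : Fin s → ℝ} (hy : ρ₀ ≤ (∑ i, u i) + ∑ i, y i) (hy' : ρ₀ ≤ (∑ i, u i) + ∑ i, y' i)
    (hyb : ∀ i, |y i| ≤ 1) :
    ‖normVec u y - normVec u y'‖ ≤ (2 * s / ρ₀ ^ 2 + 1 / ρ₀) * ‖y - y'‖ := by
  set ρ := (∑ i, u i) + ∑ i, y i with hρdef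
  set ρ' := (∑ i, u i) + ∑ i, y' i with hρ'def
  have hρ0 : 0 < ρ := lt_of_lt_of_le hρ₀ hy
  have hρ'0 : 0 < ρ' := lt_of_lt_of_le hρ₀ hy'
  set D := ‖y - y'‖ with hD
  have hD0 : 0 ≤ D := norm_nonneg _
  have hcoord : ∀ i, |y i - y' i| ≤ D := fun i => by
    rw [← Real.norm_eq_abs]; exact norm_le_pi_norm (y - y') i
  -- the denominators differ by at most `s D`
  have hdiff : |ρ - ρ'| ≤ s * D := by
    rw [hρdef, hρ'def, add_sub_add_left_eq_sub, ← Finset.sum_sub_distrib]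
    calc |∑ i, (y i - y' i)| ≤ ∑ i, |y i - y' i| := Finset.abs_sum_le_sum_abs _ _
      _ ≤ ∑ _i : Fin s, D := Finset.sum_le_sum fun i _ => hcoord i
      _ = s * D := by rw [Finset.sum_const, Finset.card_univ, Fintype.card_fin, nsmul_eq_mul]
  have hinv : |ρ⁻¹ - ρ'⁻¹| ≤ s * D / ρ₀ ^ 2 := by
    rw [inv_sub_inv hρ0.ne' hρ'0.ne', abs_div, abs_of_pos (mul_pos hρ0 hρ'0), abs_sub_comm]
    rw [div_le_div_iff₀ (mul_pos hρ0 hρ'0) (by positivity)]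
    calc |ρ - ρ'| * ρ₀ ^ 2 ≤ s * D * ρ₀ ^ 2 := mul_le_mul_of_nonneg_right hdiff (by positivity)
      _ ≤ s * D * (ρ * ρ') := by
          refine mul_le_mul_of_nonneg_left ?_ (by positivity)
          rw [sq]; exact mul_le_mul hy hy' hρ₀.le hρ0.le
  refine (pi_norm_le_iff_of_nonneg (by positivity)).2 fun i => ?_
  rw [Real.norm_eq_abs]
  simp only [Pi.sub_apply, normVec]
  rw [← hρdef, ← hρ'def]
  refine Fin.addCases (fun j => ?_) (fun j => ?_) i
  · simp only [Fin.append_left]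
    rw [div_eq_mul_inv, div_eq_mul_inv, ← mul_sub, abs_mul]
    calc |u j| * |ρ⁻¹ - ρ'⁻¹| ≤ 1 * (s * D / ρ₀ ^ 2) := mul_le_mul (hu j) hinv (abs_nonneg _) zero_le_one
      _ ≤ (2 * s / ρ₀ ^ 2 + 1 / ρ₀) * D := by
          rw [one_mul]
          have h1 : 0 ≤ s * D / ρ₀ ^ 2 := by positivity
          have h2 : 0 ≤ D / ρ₀ := by positivity
          have hid : (2 * s / ρ₀ ^ 2 + 1 / ρ₀) * D = 2 * (s * D / ρ₀ ^ 2) + D / ρ₀ := by ring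
          linarith
  · simp only [Fin.append_right]
    have hsplit : y j / ρ - y' j / ρ' = (y j - y' j) * ρ'⁻¹ + y j * (ρ⁻¹ - ρ'⁻¹) := by
      field_simp; ring
    rw [hsplit]
    calc |(y j - y' j) * ρ'⁻¹ + y j * (ρ⁻¹ - ρ'⁻¹)|
        ≤ |y j - y' j| * ρ'⁻¹ + |y j| * |ρ⁻¹ - ρ'⁻¹| := by
          refine (abs_add_le _ _).trans (le_of_eq ?_)
          rw [abs_mul, abs_mul, abs_of_pos (inv_pos.2 hρ'0)]
      _ ≤ D * ρ₀⁻¹ + 1 * (s * D / ρ₀ ^ 2) :=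
          add_le_add (mul_le_mul (hcoord j) ((inv_le_inv₀ hρ'0 hρ₀).2 hy') (inv_pos.2 hρ'0).le hD0)
            (mul_le_mul (hyb j) hinv (abs_nonneg _) zero_le_one)
      _ ≤ (2 * s / ρ₀ ^ 2 + 1 / ρ₀) * D := by
          have h1 : 0 ≤ s * D / ρ₀ ^ 2 := by positivity
          rw [one_mul]
          have hid : (2 * s / ρ₀ ^ 2 + 1 / ρ₀) * D = 2 * (s * D / ρ₀ ^ 2) + D * ρ₀⁻¹ := by ring
          linarith

/-! ### Convex polytopes are convex; pieces of a piecewise Lipschitz function -/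

/-- A convex polytope (Definition 5.7) is a convex set. [cite: FordMaynard2024PrimeSieves, Definition 5.7] -/
theorem IsConvexPolytope.convex {k : ℕ} {P : Set (Fin k → ℝ)} (hP : IsConvexPolytope P) : Convex ℝ P := by
  obtain ⟨-, S, T, rfl⟩ := hP
  intro x hx y hy a b ha hb hab
  have hlin : ∀ c : (Fin k → ℝ) × ℝ, ∑ i, c.1 i * (a • x + b • y) i =
      a * ∑ i, c.1 i * x i + b * ∑ i, c.1 i * y i := by
    intro c
    simp only [Pi.add_apply, Pi.smul_apply, smul_eq_mul, Finset.mul_sum, ← Finset.sum_add_distrib]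
    refine Finset.sum_congr rfl fun i _ => by ring
  refine ⟨fun c hc => ?_, fun c hc => ?_⟩
  · rw [hlin]
    have h1 := hx.1 c hc; have h2 := hy.1 c hc
    have hc2 : a * c.2 + b * c.2 = c.2 := by rw [← add_mul, hab, one_mul]
    rcases ha.eq_or_lt with h0 | h0
    · rw [← h0, zero_mul, zero_add]
      have : b = 1 := by linarith
      rw [this, one_mul]; exact h2
    · have : a * ∑ i, c.1 i * x i < a * c.2 := mul_lt_mul_of_pos_left h1 h0
      have : b * ∑ i, c.1 i * y i ≤ b * c.2 := mul_le_mul_of_nonneg_left h2.le hb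
      linarith
  · rw [hlin]
    have h1 := hx.2 c hc; have h2 := hy.2 c hc
    have hc2 : a * c.2 + b * c.2 = c.2 := by rw [← add_mul, hab, one_mul]
    linarith [mul_le_mul_of_nonneg_left h1 ha, mul_le_mul_of_nonneg_left h2 hb]

/-- **The pieces of a piecewise Lipschitz function** (Definition 6.2 (b)) with explicit constants:
convex measurable supports, measurable pieces, Lipschitz and sup bounds.
[cite: FordMaynard2024PrimeSieves, Definition 6.2 (b)] -/
theorem exists_pieces {k : ℕ} {g : (Fin k → ℝ) → ℝ} (hg : IsPiecewiseLipschitz g) :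
    ∃ (n : ℕ) (Pc : Fin n → Set (Fin k → ℝ)) (hp : Fin n → (Fin k → ℝ) → ℝ) (Kp Mp : Fin n → ℝ),
      (∀ j, 0 ≤ Kp j ∧ 0 ≤ Mp j) ∧
      (∀ j, Convex ℝ (Pc j) ∧ MeasurableSet (Pc j) ∧ Measurable (hp j) ∧ (∀ v, v ∉ Pc j → hp j v = 0) ∧
        (∀ v ∈ Pc j, ∀ w ∈ Pc j, |hp j v - hp j w| ≤ Kp j * ‖v - w‖) ∧ ∀ v, |hp j v| ≤ Mp j) ∧
      ∀ v, g v = ∑ j, hp j v := by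
  classical
  obtain ⟨n, Pc, hp, hP, hsum⟩ := hg
  have hdata : ∀ j, ∃ K M : ℝ, 0 ≤ K ∧ 0 ≤ M ∧
      (∀ v ∈ Pc j, ∀ w ∈ Pc j, |hp j v - hp j w| ≤ K * ‖v - w‖) ∧ ∀ v, |hp j v| ≤ M := by
    intro j
    obtain ⟨hPj, h0, K, hK⟩ := hP j
    have hlip : ∀ v ∈ Pc j, ∀ w ∈ Pc j, |hp j v - hp j w| ≤ K * ‖v - w‖ := by
      intro v hv w hw
      have := hK.dist_le_mul v hv w hw
      rwa [Real.dist_eq, dist_eq_norm] at this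
    obtain ⟨D, hD⟩ := Metric.isBounded_iff.1 hPj.1
    by_cases hne : (Pc j).Nonempty
    · obtain ⟨v₀, hv₀⟩ := hne
      refine ⟨K, |hp j v₀| + K * max D 0, K.2, by positivity, hlip, fun v => ?_⟩
      by_cases hv : v ∈ Pc j
      · have h1 := hlip v hv v₀ hv₀
        have h2 : ‖v - v₀‖ ≤ max D 0 := by
          rw [← dist_eq_norm]; exact (hD hv hv₀).trans (le_max_left _ _)
        have h3 : (K : ℝ) * ‖v - v₀‖ ≤ K * max D 0 := mul_le_mul_of_nonneg_left h2 K.2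
        calc |hp j v| = |(hp j v - hp j v₀) + hp j v₀| := by ring_nf
          _ ≤ |hp j v - hp j v₀| + |hp j v₀| := abs_add_le _ _
          _ ≤ |hp j v₀| + K * max D 0 := by linarith
      · rw [h0 v hv, abs_zero]; positivity
    · refine ⟨K, 0, K.2, le_rfl, hlip, fun v => ?_⟩
      have hv : v ∉ Pc j := fun hv => hne ⟨v, hv⟩
      rw [h0 v hv, abs_zero]
  choose Kp Mp hKM using hdata
  refine ⟨n, Pc, hp, Kp, Mp, fun j => ⟨(hKM j).1, (hKM j).2.1⟩, fun j => ?_, hsum⟩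
  obtain ⟨hPj, h0, K, hK⟩ := hP j
  have hmeas : Measurable (hp j) := by
    have hpw : hp j = (Pc j).piecewise (hp j) (fun _ => 0) := by
      funext v
      by_cases hv : v ∈ Pc j
      · rw [Set.piecewise_eq_of_mem _ _ _ hv]
      · rw [Set.piecewise_eq_of_notMem _ _ _ hv, h0 v hv]
    rw [hpw]
    exact ContinuousOn.measurable_piecewise hK.continuousOn continuousOn_const hPj.measurableSet
  exact ⟨hPj.convex, hPj.measurableSet, hmeas, h0, (hKM j).2.2.1, (hKM j).2.2.2⟩

/-! ### Comparison of `primeTupleSum (mainG)` with its integral -/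

/-- A coordinate of a vector with nonnegative entries is at most the sum. [folklore] -/
theorem apply_le_sum_of_nonneg {s : ℕ} {y : Fin s → ℝ} (hy : ∀ i, 0 ≤ y i) (i : Fin s) :
    y i ≤ ∑ j, y j :=
  Finset.single_le_sum (fun j _ => hy j) (Finset.mem_univ i)

/-- **`primeTupleSum (mainG) = primeTupleIntegral (mainG) + O(x^{c₁}/(log x)^A)`.** The test
function `mainG h t s u c₀ c₁` is decomposed along the pieces of `h|ℝ^{t+s}` (Definition 6.2 (b))
into functions Lipschitz on convex sets (preimages of the polytopes under the normalisation
`y ↦ (u,y)/(λ+|y|)`, intersected with the range region), and `exists_primeTupleSum_approx` (passed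
as the hypothesis `hF2`, at `η' = η/2`) is applied to each piece. Hypotheses: `|uᵢ| ≤ 1`,
`λ + c₀ ≥ 1/2`, `c₁ ≤ 1`. [cite: FordMaynard2024PrimeSieves, §6.2 (proof of Theorem 6.3 (a), application of Lemma 5.11)] -/
theorem abs_primeTupleSum_mainG_sub_integral_le {h : VecFn} {η : ℝ} (hη : 0 < η)
    (hsupp : ∀ (k : ℕ) (v : Fin k → ℝ), h k v ≠ 0 → ∀ i, η ≤ v i)
    {s A : ℕ} {CF X x : ℝ}
    (hF2 : ∀ x' : ℝ, X ≤ x' → ∀ (U : Set (Fin s → ℝ)) (G : (Fin s → ℝ) → ℝ) (K M Y : ℝ),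
      Convex ℝ U → MeasurableSet U → (∀ y ∈ U, ∀ i, η / 2 ≤ y i) → (∀ y ∈ U, ∑ i, y i ≤ Y) →
      Y ≤ 1 → 0 ≤ K → 0 ≤ M → Measurable G →
      (∀ y ∈ U, ∀ y' ∈ U, |G y - G y'| ≤ K * ‖y - y'‖) → (∀ y, |G y| ≤ M) →
      (∀ y, y ∉ U → G y = 0) →
      |primeTupleSum s x' G - primeTupleIntegral s x' G| ≤ CF * (K + M) * x' ^ Y / Real.log x' ^ A)
    (hxX : X ≤ x) (hx : 1 < x) {t : ℕ} {u : Fin t → ℝ} (hu : ∀ i, |u i| ≤ 1) {c₀ c₁ : ℝ}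
    (hc₁ : c₁ ≤ 1) (hρ : 1 / 2 ≤ (∑ i, u i) + c₀)
    {n : ℕ} {Pc : Fin n → Set (Fin (t + s) → ℝ)} {hp : Fin n → (Fin (t + s) → ℝ) → ℝ}
    {Kp Mp : Fin n → ℝ} (hKM : ∀ j, 0 ≤ Kp j ∧ 0 ≤ Mp j)
    (hpc : ∀ j, Convex ℝ (Pc j) ∧ MeasurableSet (Pc j) ∧ Measurable (hp j) ∧
      (∀ v, v ∉ Pc j → hp j v = 0) ∧
      (∀ v ∈ Pc j, ∀ w ∈ Pc j, |hp j v - hp j w| ≤ Kp j * ‖v - w‖) ∧ ∀ v, |hp j v| ≤ Mp j)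
    (hsum : ∀ v, h (t + s) v = ∑ j, hp j v) :
    |primeTupleSum s x (mainG h t s u c₀ c₁) - primeTupleIntegral s x (mainG h t s u c₀ c₁)| ≤
      CF * (∑ j, (Kp j * (8 * s + 2) + Mp j)) * x ^ c₁ / Real.log x ^ A := by
  classical
  have hx0 : 0 < x := by linarith
  -- the region `E` and the pieces
  set E : Set (Fin s → ℝ) := {y | (∀ i, η / 2 ≤ y i) ∧ c₀ < ∑ i, y i ∧ ∑ i, y i ≤ c₁} with hE
  set U : Fin n → Set (Fin s → ℝ) := fun j => E ∩ {y | normVec u y ∈ Pc j} with hU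
  set G : Fin n → (Fin s → ℝ) → ℝ := fun j => (U j).indicator (fun y => hp j (normVec u y)) with hG
  -- basic facts on `E`
  have hEρ : ∀ y ∈ E, 1 / 2 ≤ (∑ i, u i) + ∑ i, y i := fun y hy => by linarith [hy.2.1]
  have hEbox : ∀ y ∈ E, ∀ i, η / 2 ≤ y i ∧ y i ≤ 1 := by
    intro y hy i
    refine ⟨hy.1 i, ?_⟩
    have := apply_le_sum_of_nonneg (fun j => (by linarith [hy.1 j] : 0 ≤ y j)) i
    linarith [hy.2.2]
  have hEabs : ∀ y ∈ E, ∀ i, |y i| ≤ 1 := fun y hy i => by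
    rw [abs_le]; exact ⟨by linarith [(hEbox y hy i).1], (hEbox y hy i).2⟩
  have hEm : MeasurableSet E := by
    have : E = ((⋂ i, {y : Fin s → ℝ | η / 2 ≤ y i}) ∩ {y | c₀ < ∑ i, y i}) ∩ {y | ∑ i, y i ≤ c₁} := by
      ext y; simp [hE, and_assoc]
    rw [this]
    refine ((MeasurableSet.iInter fun i => measurableSet_le measurable_const (measurable_pi_apply i)).inter
      (measurableSet_lt measurable_const (Finset.measurable_sum _ fun i _ => measurable_pi_apply i))).inter
      (measurableSet_le (Finset.measurable_sum _ fun i _ => measurable_pi_apply i) measurable_const)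
  have hEconv : Convex ℝ E := by
    intro y hy y' hy' a b ha hb hab
    have hηc : a * (η / 2) + b * (η / 2) = η / 2 := by rw [← add_mul, hab, one_mul]
    have hc1 : a * c₁ + b * c₁ = c₁ := by rw [← add_mul, hab, one_mul]
    have hsz : ∑ i, (a • y + b • y') i = a * ∑ i, y i + b * ∑ i, y' i := by
      simp only [Pi.add_apply, Pi.smul_apply, smul_eq_mul, Finset.sum_add_distrib, ← Finset.mul_sum]
    refine ⟨fun i => ?_, ?_, ?_⟩
    · simp only [Pi.add_apply, Pi.smul_apply, smul_eq_mul]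
      linarith [mul_le_mul_of_nonneg_left (hy.1 i) ha, mul_le_mul_of_nonneg_left (hy'.1 i) hb]
    · rw [hsz]
      rcases ha.eq_or_lt with h0 | h0
      · rw [← h0, zero_mul, zero_add, show b = 1 by linarith, one_mul]; exact hy'.2.1
      · have := mul_lt_mul_of_pos_left hy.2.1 h0
        have := mul_le_mul_of_nonneg_left hy'.2.1.le hb
        have hc0 : a * c₀ + b * c₀ = c₀ := by rw [← add_mul, hab, one_mul]
        linarith
    · rw [hsz]
      linarith [mul_le_mul_of_nonneg_left hy.2.2 ha, mul_le_mul_of_nonneg_left hy'.2.2 hb]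
  -- the pieces satisfy the hypotheses of `hF2`
  have hUconv : ∀ j, Convex ℝ (U j) := by
    intro j y hy y' hy' a b ha hb hab
    refine ⟨hEconv hy.1 hy'.1 ha hb hab, ?_⟩
    obtain ⟨a', b', ha', hb', hab', heq⟩ := normVec_convex_comb u (y := y) (y' := y') ha hb hab
      (by linarith [hEρ y hy.1]) (by linarith [hEρ y' hy'.1])
    show normVec u (a • y + b • y') ∈ Pc j
    rw [heq]
    exact (hpc j).1 hy.2 hy'.2 ha' hb' hab'
  have hUm : ∀ j, MeasurableSet (U j) := fun j =>
    hEm.inter ((hpc j).2.1.preimage (measurable_normVec u))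
  have hGm : ∀ j, Measurable (G j) := fun j =>
    ((hpc j).2.2.1.comp (measurable_normVec u)).indicator (hUm j)
  have hGlip : ∀ j, ∀ y ∈ U j, ∀ y' ∈ U j, |G j y - G j y'| ≤ Kp j * (8 * s + 2) * ‖y - y'‖ := by
    intro j y hy y' hy'
    simp only [hG, Set.indicator_of_mem hy, Set.indicator_of_mem hy']
    have h1 := (hpc j).2.2.2.2.1 _ hy.2 _ hy'.2
    have h2 := norm_normVec_sub_le hu (by norm_num : (0 : ℝ) < 1 / 2) (hEρ y hy.1) (hEρ y' hy'.1)
      (hEabs y hy.1) (s := s)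
    have h3 : (2 * (s : ℝ) / (1 / 2) ^ 2 + 1 / (1 / 2)) = 8 * s + 2 := by ring
    rw [h3] at h2
    calc |hp j (normVec u y) - hp j (normVec u y')| ≤ Kp j * ‖normVec u y - normVec u y'‖ := h1
      _ ≤ Kp j * ((8 * s + 2) * ‖y - y'‖) := mul_le_mul_of_nonneg_left h2 (hKM j).1
      _ = Kp j * (8 * s + 2) * ‖y - y'‖ := by ring
  have hGbd : ∀ j y, |G j y| ≤ Mp j := by
    intro j y
    simp only [hG, Set.indicator]
    split_ifs
    · exact (hpc j).2.2.2.2.2 _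
    · rw [abs_zero]; exact (hKM j).2
  have hGzero : ∀ j y, y ∉ U j → G j y = 0 := fun j y hy => Set.indicator_of_notMem hy _
  have hpiece : ∀ j, |primeTupleSum s x (G j) - primeTupleIntegral s x (G j)| ≤
      CF * (Kp j * (8 * s + 2) + Mp j) * x ^ c₁ / Real.log x ^ A :=
    fun j => hF2 x hxX (U j) (G j) (Kp j * (8 * s + 2)) (Mp j) c₁ (hUconv j) (hUm j)
      (fun y hy i => (hy.1).1 i) (fun y hy => hy.1.2.2) hc₁ (by nlinarith [(hKM j).1]) (hKM j).2 (hGm j)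
      (hGlip j) (hGbd j) (hGzero j)
  -- `mainG = ∑_j G j`
  have hdecomp : ∀ y, mainG h t s u c₀ c₁ y = ∑ j, G j y := by
    intro y
    by_cases hyE : y ∈ E
    · have hmain : mainG h t s u c₀ c₁ y = h (t + s) (normVec u y) := by
        unfold mainG; rw [if_pos ⟨hyE.2.1, hyE.2.2⟩]
      rw [hmain, hsum]
      refine Finset.sum_congr rfl fun j _ => ?_
      simp only [hG, Set.indicator, hU, Set.mem_inter_iff, Set.mem_setOf_eq]
      by_cases hj : normVec u y ∈ Pc j
      · rw [if_pos ⟨hyE, hj⟩]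
      · rw [if_neg (fun h => hj h.2), (hpc j).2.2.2.1 _ hj]
    · have hzero : mainG h t s u c₀ c₁ y = 0 := by
        by_contra hne
        obtain ⟨hc, hcoord⟩ := mainG_ne_zero_imp hsupp (by linarith) hne
        refine hyE ⟨fun i => ?_, hc.1, hc.2⟩
        have := hcoord i
        have hρ' : 1 / 2 ≤ (∑ i, u i) + ∑ i, y i := by linarith [hc.1]
        nlinarith
      rw [hzero]
      symm
      refine Finset.sum_eq_zero fun j _ => hGzero j y fun hy => hyE hy.1
  -- linearity of both sides
  have hPS : primeTupleSum s x (mainG h t s u c₀ c₁) = ∑ j, primeTupleSum s x (G j) := by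
    unfold primeTupleSum
    rw [Finset.sum_congr rfl (fun q _ => hdecomp (logVec x q)), Finset.sum_comm]
  have hGint : ∀ j, Integrable (fun y => G j y * tupleWeight x y) := by
    intro j
    refine integrable_of_bdd_of_support_box ((hGm j).mul (measurable_tupleWeight hx0))
      (B := Mp j * (x / (η / 2)) ^ s) (a := η / 2) (b := 1) (fun y => ?_) (fun y hy => ?_)
    · by_cases hy : y ∈ U j
      · have hw := tupleWeight_bounds hx.le (by positivity : 0 < η / 2) (hEbox y hy.1)
        rw [abs_mul, abs_of_nonneg hw.1]
        exact mul_le_mul (hGbd j y) hw.2 hw.1 (hKM j).2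
      · rw [hGzero j y hy, zero_mul, abs_zero]
        exact mul_nonneg (hKM j).2 (by positivity)
    · have hyU : y ∈ U j := by
        by_contra hc; exact hy (by rw [hGzero j y hc, zero_mul])
      exact ⟨fun i => (hEbox y hyU.1 i).1, fun i => (hEbox y hyU.1 i).2⟩
  have hIN : primeTupleIntegral s x (mainG h t s u c₀ c₁) = ∑ j, primeTupleIntegral s x (G j) := by
    unfold primeTupleIntegral
    rw [← integral_finsetSum _ (fun j _ => hGint j)]
    refine integral_congr_ae (Filter.Eventually.of_forall fun y => ?_)
    show mainG h t s u c₀ c₁ y * tupleWeight x y = ∑ i, G i y * tupleWeight x y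
    rw [hdecomp y, Finset.sum_mul]
  rw [hPS, hIN, ← Finset.sum_sub_distrib]
  calc |∑ j, (primeTupleSum s x (G j) - primeTupleIntegral s x (G j))|
      ≤ ∑ j, |primeTupleSum s x (G j) - primeTupleIntegral s x (G j)| := Finset.abs_sum_le_sum_abs _ _
    _ ≤ ∑ j, CF * (Kp j * (8 * s + 2) + Mp j) * x ^ c₁ / Real.log x ^ A := Finset.sum_le_sum fun j _ => hpiece j
    _ = CF * (∑ j, (Kp j * (8 * s + 2) + Mp j)) * x ^ c₁ / Real.log x ^ A := by
        rw [Finset.mul_sum, Finset.sum_mul, Finset.sum_div]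

end Literature.NumberTheory.Sieve.FordMaynard
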